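import Summits.BirchSwinnertonDyer.BirchSwinnertonDyer.Theorems.GenusKolyvaginAtTwoGenusPrimitiveSupplyAtTwoTwistUnramifiedGoodNorm
import HarnessLib

/-!
# Route `GenusKolyvaginAtTwo`, crux #2 `GenusPrimitiveSupplyAtTwo` (stmt-BirchSwinnertonDyer-22136):
# MAZUR–RUBIN LEMMA 2.10 (v) AT EVERY FINITE PLACE, `v ∣ 2` INCLUDED — the row `φ_* 𝓛_v(Wd) = 𝓛_v(W)` for good reduction
# unramified in `K(√d)`, and ONE identification `E^{(d)}[2] ≅ E[2]` carrying Lemma 2.10 (i) + (v) together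

Width seat `bsd-line-gk2-p5` g11 (cell `bsd-f1-sign2`, SUPPLY lineage), file 39 of the series (sequel of `…TwistUnramifiedGoodNorm.lean`,
§89–§90: Mazur's norm theorem `E_N(K_v) = E(K_v)` in the engine's currency). THEOREMS ONLY (no definition, no named fact, no `sorry`,
no local instance); helper `--supports stmt-BirchSwinnertonDyer-22136`; no item is closed; BSD is not proved by any of this.

* §91 **`map_kummerLocalConditionAt_adicCompletion_eq_of_hasGoodReductionAt_of_mem_maxUnramified`** — LEMMA 2.10 (v) of Mazur–Rubin
  2010 at a finite place `v` of a number field, `v ∣ 2` allowed: for the signed pair `(χ, θ)` of file 6, `W` good at `v`,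
  `ι√d ∈ K_v^{nr}`, `d ∉ K_v²` ⟹ `φ_* 𝓛_v(Wd) = 𝓛_v(W)` (engine `map_kummerLocalConditionAt_adicCompletion_eq_of_forall_exists_norm`
  of file 35 fed with §90's `hnorm`);
* §92 **`exists_intertwining_hsplit_and_signed`** — the master datum: ONE pair of inverse intertwinings `φ : Wd[2] ⇄ W[2] : φ'` with
  Lemma 2.10 (i) (`hsplit`, proof copied from `GenusKolyTwistLocal.exists_intertwining_hsplit_and_transverse`) AND the signed local
  untwistings `θ_E` at every `K`-field `E` DISPLAYED (so further rows are derived for the same `φ`);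
  **`exists_intertwining_hsplit_and_unramifiedGood`** — Lemma 2.10 (i) + (v): agreement at every finite place of good reduction
  unramified in `K(√d)` (the sub-case `d ∈ K_v²` by (i)). This is the dyadic row the lead's g9 memo §3 recorded as «not dischargeable»
  (`MazurRubin2010.d2_eq_of_lemma210_rat`, row (v) at `2` inert; T-A⁵ `UnramifiedTwistSelmerShiftAtTwo`).

References: [MazurRubin2010] Remark 2.4, Lemma 2.9, Lemma 2.10 (i), (v) (arXiv:0904.3709 p. 7); [Mazur1972] Cor. 4.4; [KramerTunnell1982]
§6 Lemma 6.1 (type I₀); [SilvermanAEC2009] X.2 Prop. 2.4, X.5 Cor. 5.4.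
-/

set_option linter.dupNamespace false -- tree convention: `Summit.BirchSwinnertonDyer.BirchSwinnertonDyer.Theorems` (summit = sub-problem)
set_option autoImplicit false

noncomputable section

open scoped Classical ContRepresentation ValuativeRel

namespace Summit.BirchSwinnertonDyer.BirchSwinnertonDyer.Theorems.GenusKolyArch

open WeierstrassCurve Field NumberField IsDedekindDomain Function
open Literature.NumberTheory.EllipticCurves Literature.NumberTheory.GaloisRepresentations
open Literature.NumberTheory.GaloisRepresentations.IsNonarchimedeanLocalField (maxUnramified)
open Literature.NumberTheory.GaloisCohomology
open Summit.BirchSwinnertonDyer.Rank1Residual.X11b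
open Summit.BirchSwinnertonDyer.Rank1Residual.X11b.CongruentTransfer
open Summit.BirchSwinnertonDyer.BirchSwinnertonDyer.Theorems.GenusKolyTwistLocal (exists_addEquiv_geomTorsion_two_localSquare_signed
  smul_closureEmb_geomSqrt_eq)

/-! ## §91 Lemma 2.10 (v) at every finite place (dyadic included), and the `φ`-packaged form -/

section Row

variable {K : Type} [Field K] [NumberField K] (W : WeierstrassCurve K) [W.IsElliptic]
  {Wd : WeierstrassCurve K} [Wd.IsElliptic]
  (χ : (Wd.torsionGaloisModule ((2 : ℕ) : ℤ)).toContRepresentation →ⁱL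
    (W.torsionGaloisModule ((2 : ℕ) : ℤ)).toContRepresentation)
  (ψ : (W.torsionGaloisModule ((2 : ℕ) : ℤ)).toContRepresentation →ⁱL
    (Wd.torsionGaloisModule ((2 : ℕ) : ℤ)).toContRepresentation)
  (hψχ : ∀ a, ψ (χ a) = a) (hχψ : ∀ b, χ (ψ b) = b)
  (v : HeightOneSpectrum (𝓞 K))

include hψχ hχψ in
/-- **MAZUR–RUBIN LEMMA 2.10 (v) at a finite place `v` of a number field, `v ∣ 2` INCLUDED.** `W, Wd` elliptic over `K` with inverse
intertwinings `χ : Wd[2] → W[2]`, `ψ`, and at `K_v` the signed untwisting `θ` of file 6 (`θ(σP) = ±σθP` according as `σ` fixes /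
flips `ι√d`, the dichotomy, `ι_*(χ t) = θ(ι_* t)`); IF `W` has GOOD reduction at `v`, `ι√d ∈ K_v^{nr}` (`v` unramified in
`K(√d)`) and `d ∉ K_v²`, THEN `φ_* 𝓛_v(Wd) = 𝓛_v(W)`. Proof as printed: Lemma 2.9 (`⊇` = file 34's cocycle identity for norms) +
Mazur's `E_N(K_v) = E(K_v)` (§90) + the count of file 35. (For `d ∈ K_v²` use Lemma 2.10 (i), `hsplit`.)
[cite: MazurRubin2010, Lemma 2.10 (v) and its proof (arXiv:0904.3709 p. 7)] [cite: KramerTunnell1982, §6 Lemma 6.1 (p. 327), type I₀] -/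
theorem map_kummerLocalConditionAt_adicCompletion_eq_of_hasGoodReductionAt_of_mem_maxUnramified {d : K}
    (θ : localPoints Wd (v.adicCompletion K) ≃+ localPoints W (v.adicCompletion K))
    (hfix : ∀ σ : absoluteGaloisGroup (v.adicCompletion K),
      (show AlgebraicClosure (v.adicCompletion K) ≃ₐ[v.adicCompletion K] AlgebraicClosure (v.adicCompletion K) from σ)
          (closureEmb (K := K) (v.adicCompletion K) (geomSqrt d)) = closureEmb (K := K) (v.adicCompletion K) (geomSqrt d) →
        ∀ P : localPoints Wd (v.adicCompletion K), θ (σ • P) = σ • θ P)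
    (hneg : ∀ σ : absoluteGaloisGroup (v.adicCompletion K),
      (show AlgebraicClosure (v.adicCompletion K) ≃ₐ[v.adicCompletion K] AlgebraicClosure (v.adicCompletion K) from σ)
          (closureEmb (K := K) (v.adicCompletion K) (geomSqrt d)) = -closureEmb (K := K) (v.adicCompletion K) (geomSqrt d) →
        ∀ P : localPoints Wd (v.adicCompletion K), θ (σ • P) = -(σ • θ P))
    (hdich : ∀ σ : absoluteGaloisGroup (v.adicCompletion K),
      (show AlgebraicClosure (v.adicCompletion K) ≃ₐ[v.adicCompletion K] AlgebraicClosure (v.adicCompletion K) from σ)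
          (closureEmb (K := K) (v.adicCompletion K) (geomSqrt d)) = closureEmb (K := K) (v.adicCompletion K) (geomSqrt d) ∨
        (show AlgebraicClosure (v.adicCompletion K) ≃ₐ[v.adicCompletion K] AlgebraicClosure (v.adicCompletion K) from σ)
          (closureEmb (K := K) (v.adicCompletion K) (geomSqrt d)) = -closureEmb (K := K) (v.adicCompletion K) (geomSqrt d))
    (hχ : ∀ t : geomTorsion Wd ((2 : ℕ) : ℤ),
      pointsMap W (v.adicCompletion K) (χ t : geomPoints W) = θ (pointsMap Wd (v.adicCompletion K) (t : geomPoints Wd)))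
    (hv : W.HasGoodReductionAt v)
    (hα : closureEmb (K := K) (v.adicCompletion K) (geomSqrt d) ∈ maxUnramified (v.adicCompletion K))
    (hd : ∀ s : v.adicCompletion K, s ^ 2 ≠ algebraMap K (v.adicCompletion K) d) :
    (Wd.kummerLocalConditionAt ((2 : ℕ) : ℤ) (v.adicCompletion K)).map
        (galoisCohomology.map (χ.restrictField (v.adicCompletion K)) 1) =
      W.kummerLocalConditionAt ((2 : ℕ) : ℤ) (v.adicCompletion K) := by
  obtain ⟨τ₀, hτ₀⟩ := exists_flip_closureEmb_geomSqrt (K := K) (d := d) v hd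
  exact map_kummerLocalConditionAt_adicCompletion_eq_of_forall_exists_norm W χ ψ hψχ hχψ v θ hfix hneg hdich hχ hτ₀
    (forall_exists_norm_of_hasGoodReductionAt_of_mem_maxUnramified W v hv hα hd hτ₀)

end Row

/-! ## §92 One identification with Lemma 2.10 (i), the signed untwistings, and the good-unramified row -/

section Packaged

variable {K : Type} [Field K] [NumberField K] (W Wd : WeierstrassCurve K) [W.IsElliptic] [Wd.IsElliptic]

omit [W.IsElliptic] [Wd.IsElliptic] in
/-- **ONE identification `E^{(d)}[2] ≅ E[2]` with Lemma 2.10 (i) AND its signed local untwistings DISPLAYED.** For `W/K` elliptic,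
`d ≠ 0`, `Wd = C • W^{(d)}` elliptic: mutually inverse `Γ_K`-intertwinings `φ : Wd[2] ⇄ W[2] : φ'` (the untwisting of file 6,
`exists_addEquiv_geomTorsion_two_localSquare_signed`), the split-place agreement `hsplit` (Lemma 2.10 (i), proof copied from
`GenusKolyTwistLocal.exists_intertwining_hsplit_and_transverse`), and at EVERY `K`-field `E` a signed untwisting `θ_E` on local
points (`θ(σP) = σθP` / `−σθP` as `σ` fixes / flips `ι√d`, the dichotomy) intertwined with `φ` on `Wd[2]` — the master datum from
which every further Lemma-2.10 row (this file's (v); Kramer's multiplicative rows) is derived for the SAME `φ`.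
[cite: MazurRubin2010, Remark 2.4, Lemma 2.10 (i)] [cite: SilvermanAEC2009, X.2 Prop. 2.4, X.5 Cor. 5.4] -/
theorem exists_intertwining_hsplit_and_signed {d : K} (hd : d ≠ 0) {C : VariableChange K}
    (hWd : C • W.quadraticTwist d = Wd) :
    ∃ (φ : (Wd.torsionGaloisModule ((2 : ℕ) : ℤ)).toContRepresentation →ⁱL
        (W.torsionGaloisModule ((2 : ℕ) : ℤ)).toContRepresentation)
      (φ' : (W.torsionGaloisModule ((2 : ℕ) : ℤ)).toContRepresentation →ⁱL
        (Wd.torsionGaloisModule ((2 : ℕ) : ℤ)).toContRepresentation),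
      (∀ a, φ' (φ a) = a) ∧ (∀ b, φ (φ' b) = b) ∧
      (∀ (E : Type) [Field E] [Algebra K E], (∃ s : E, s ^ 2 = algebraMap K E d) →
        (Wd.kummerLocalConditionAt ((2 : ℕ) : ℤ) E).map (galoisCohomology.map (φ.restrictField E) 1) =
          W.kummerLocalConditionAt ((2 : ℕ) : ℤ) E) ∧
      ∀ (E : Type) [Field E] [Algebra K E], ∃ θ : localPoints Wd E ≃+ localPoints W E,
        (∀ σ : absoluteGaloisGroup E,
          (show AlgebraicClosure E ≃ₐ[E] AlgebraicClosure E from σ) (closureEmb (K := K) E (geomSqrt d)) =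
              closureEmb (K := K) E (geomSqrt d) → ∀ P : localPoints Wd E, θ (σ • P) = σ • θ P) ∧
        (∀ σ : absoluteGaloisGroup E,
          (show AlgebraicClosure E ≃ₐ[E] AlgebraicClosure E from σ) (closureEmb (K := K) E (geomSqrt d)) =
              -closureEmb (K := K) E (geomSqrt d) → ∀ P : localPoints Wd E, θ (σ • P) = -(σ • θ P)) ∧
        (∀ σ : absoluteGaloisGroup E,
          (show AlgebraicClosure E ≃ₐ[E] AlgebraicClosure E from σ) (closureEmb (K := K) E (geomSqrt d)) =
              closureEmb (K := K) E (geomSqrt d) ∨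
            (show AlgebraicClosure E ≃ₐ[E] AlgebraicClosure E from σ) (closureEmb (K := K) E (geomSqrt d)) =
              -closureEmb (K := K) E (geomSqrt d)) ∧
        ∀ t : geomTorsion Wd ((2 : ℕ) : ℤ), pointsMap W E (φ t : geomPoints W) = θ (pointsMap Wd E (t : geomPoints Wd)) := by
  haveI : NeZero (2 : K) := ⟨two_ne_zero⟩
  obtain ⟨ψ, hψ, hloc⟩ := exists_addEquiv_geomTorsion_two_localSquare_signed W hd hWd
  have hψ' : ∀ (σ : absoluteGaloisGroup K) (Q : geomTorsion W (2 : ℤ)),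
      ψ.symm (σ • Q) = σ • ψ.symm Q := fun σ Q ↦
    ψ.injective (by rw [hψ, ψ.apply_symm_apply, ψ.apply_symm_apply])
  let φ : (Wd.torsionGaloisModule ((2 : ℕ) : ℤ)).toContRepresentation →ⁱL
      (W.torsionGaloisModule ((2 : ℕ) : ℤ)).toContRepresentation :=
    { toContinuousLinearMap := ⟨ψ.toAddMonoidHom.toIntLinearMap, continuous_of_discreteTopology⟩
      isIntertwining' := fun σ ↦ by
        ext P
        exact congrArg Subtype.val (hψ σ P) }
  let φ' : (W.torsionGaloisModule ((2 : ℕ) : ℤ)).toContRepresentation →ⁱL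
      (Wd.torsionGaloisModule ((2 : ℕ) : ℤ)).toContRepresentation :=
    { toContinuousLinearMap := ⟨ψ.symm.toAddMonoidHom.toIntLinearMap, continuous_of_discreteTopology⟩
      isIntertwining' := fun σ ↦ by
        ext Q
        exact congrArg Subtype.val (hψ' σ Q) }
  have hφ : ∀ a, φ a = ψ a := fun _ ↦ rfl
  have hφ' : ∀ b, φ' b = ψ.symm b := fun _ ↦ rfl
  -- one inclusion of Lemma 2.10 (i), for an arbitrary Γ_E-equivariant intertwined local datum
  -- (copied from `GenusKolyTwistLocal.exists_intertwining_hsplit_and_transverse`)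
  have key : ∀ (E : Type) [Field E] [Algebra K E] {X Y : WeierstrassCurve K}
      (χ : (X.torsionGaloisModule ((2 : ℕ) : ℤ)).toContRepresentation →ⁱL
        (Y.torsionGaloisModule ((2 : ℕ) : ℤ)).toContRepresentation) (η : localPoints X E ≃+ localPoints Y E),
      (∀ (σ : absoluteGaloisGroup E) (Q : localPoints X E), η (σ • Q) = σ • η Q) →
      (∀ t : geomTorsion X ((2 : ℕ) : ℤ),
        pointsMap Y E (χ t : geomPoints Y) = η (pointsMap X E (t : geomPoints X))) →
      ∀ x ∈ X.kummerLocalConditionAt ((2 : ℕ) : ℤ) E,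
        galoisCohomology.map (χ.restrictField E) 1 x ∈ Y.kummerLocalConditionAt ((2 : ℕ) : ℤ) E := by
    intro E _ _ X Y χ η hη hχ x hx
    obtain ⟨f, rfl⟩ := oneCocycleClass_surjective
      (DiscreteGaloisModule.toTopRep (GaloisRep.restrictField E (X.torsionGaloisModule ((2 : ℕ) : ℤ)))) x
    rw [mem_kummerLocalConditionAt_iff, map_torsionPointsMapIntertwining_oneCocycleClass] at hx
    obtain ⟨Q, hQ⟩ := (oneCocycleClass_eq_zero_iff _ _).mp hx
    have hQ' : ∀ σ : absoluteGaloisGroup E,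
        pointsMap X E ((f.1 σ : geomTorsion X ((2 : ℕ) : ℤ)) : geomPoints X) = σ • Q - Q := hQ
    rw [galoisCohomology.map_one_oneCocycleClass, mem_kummerLocalConditionAt_iff,
      map_torsionPointsMapIntertwining_oneCocycleClass]
    refine (oneCocycleClass_eq_zero_iff _ _).mpr ⟨η Q, fun σ ↦ ?_⟩
    change pointsMap Y E ((χ (f.1 σ) : geomTorsion Y ((2 : ℕ) : ℤ)) : geomPoints Y) = σ • η Q - η Q
    rw [hχ, hQ', map_sub, hη]
  refine ⟨φ, φ', fun a ↦ ψ.symm_apply_apply a, fun b ↦ ψ.apply_symm_apply b, fun E _ _ hsq ↦ ?_, fun E _ _ ↦ ?_⟩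
  · -- (i) split places: every σ fixes ι(√d), θ_E is Γ_E-equivariant
    obtain ⟨s, hs⟩ := hsq
    obtain ⟨θ, hfix, -, -, hsquare⟩ := hloc E
    have hθ : ∀ (σ : absoluteGaloisGroup E) (Q : localPoints Wd E), θ (σ • Q) = σ • θ Q :=
      fun σ Q ↦ hfix σ (smul_closureEmb_geomSqrt_eq E hs σ) Q
    have hθ' : ∀ (σ : absoluteGaloisGroup E) (Q : localPoints W E), θ.symm (σ • Q) = σ • θ.symm Q :=
      symm_equivariant θ hθ
    have hsquare' : ∀ t : geomTorsion W ((2 : ℕ) : ℤ),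
        pointsMap Wd E (ψ.symm t : geomPoints Wd) = θ.symm (pointsMap W E (t : geomPoints W)) := fun t ↦ by
      apply θ.injective
      rw [← hsquare (ψ.symm t), ψ.apply_symm_apply, θ.apply_symm_apply]
    apply le_antisymm
    · rw [AddSubgroup.map_le_iff_le_comap]
      intro x hx
      exact key E φ θ hθ (fun t ↦ by rw [hφ]; exact hsquare t) x hx
    · intro y hy
      refine ⟨galoisCohomology.map (φ'.restrictField E) 1 y,
        key E φ' θ.symm hθ' (fun t ↦ by rw [hφ']; exact hsquare' t) y hy, ?_⟩
      obtain ⟨f, rfl⟩ := oneCocycleClass_surjective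
        (DiscreteGaloisModule.toTopRep (GaloisRep.restrictField E (W.torsionGaloisModule ((2 : ℕ) : ℤ)))) y
      rw [galoisCohomology.map_one_oneCocycleClass, galoisCohomology.map_one_oneCocycleClass]
      congr 1
      apply Subtype.ext
      ext g : 1
      rw [contOneCocycles.pullback_apply, contOneCocycles.pullback_apply]
      exact ψ.apply_symm_apply (f.1 g)
  · obtain ⟨θ, hfix, hneg, hdich, hsquare⟩ := hloc E
    exact ⟨θ, hfix, hneg, hdich, fun t ↦ by rw [hφ]; exact hsquare t⟩

/-- **Lemma 2.10 (i) and LEMMA 2.10 (v) (dyadic places included) for ONE identification `E^{(d)}[2] ≅ E[2]`.** For `W/K`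
elliptic over a number field, `d ≠ 0`, `Wd = C • W^{(d)}` elliptic: inverse intertwinings `φ, φ'` with the split-place agreement
AND, at every finite place `v` where `W` has GOOD reduction and `ι√d ∈ K_v^{nr}` (`v` unramified in `K(√d)`; `v ∣ 2` allowed),
`φ_* 𝓛_v(Wd) = 𝓛_v(W)` (the sub-case `d ∈ K_v²` by (i), the inert sub-case by §91). This is the input shape of the place menus
(`GenusKolyTwistTamagawa.transport_twist_agree_inr_of_menu` and its sequel with the unramified-good row).
[cite: MazurRubin2010, Lemma 2.10 (i), (v)] [cite: KramerTunnell1982, §6 Lemma 6.1 (p. 327), type I₀] -/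
theorem exists_intertwining_hsplit_and_unramifiedGood {d : K} (hd : d ≠ 0) {C : VariableChange K}
    (hWd : C • W.quadraticTwist d = Wd) :
    ∃ (φ : (Wd.torsionGaloisModule ((2 : ℕ) : ℤ)).toContRepresentation →ⁱL
        (W.torsionGaloisModule ((2 : ℕ) : ℤ)).toContRepresentation)
      (φ' : (W.torsionGaloisModule ((2 : ℕ) : ℤ)).toContRepresentation →ⁱL
        (Wd.torsionGaloisModule ((2 : ℕ) : ℤ)).toContRepresentation),
      (∀ a, φ' (φ a) = a) ∧ (∀ b, φ (φ' b) = b) ∧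
      (∀ (E : Type) [Field E] [Algebra K E], (∃ s : E, s ^ 2 = algebraMap K E d) →
        (Wd.kummerLocalConditionAt ((2 : ℕ) : ℤ) E).map (galoisCohomology.map (φ.restrictField E) 1) =
          W.kummerLocalConditionAt ((2 : ℕ) : ℤ) E) ∧
      ∀ (v : HeightOneSpectrum (𝓞 K)), W.HasGoodReductionAt v →
        closureEmb (K := K) (v.adicCompletion K) (geomSqrt d) ∈ maxUnramified (v.adicCompletion K) →
        (Wd.kummerLocalConditionAt ((2 : ℕ) : ℤ) (v.adicCompletion K)).map
            (galoisCohomology.map (φ.restrictField (v.adicCompletion K)) 1) =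
          W.kummerLocalConditionAt ((2 : ℕ) : ℤ) (v.adicCompletion K) := by
  obtain ⟨φ, φ', hφ'φ, hφφ', hsplit, hloc⟩ := exists_intertwining_hsplit_and_signed W Wd hd hWd
  refine ⟨φ, φ', hφ'φ, hφφ', hsplit, fun v hv hα ↦ ?_⟩
  by_cases hsq : ∃ s : v.adicCompletion K, s ^ 2 = algebraMap K (v.adicCompletion K) d
  · exact hsplit (v.adicCompletion K) hsq
  · obtain ⟨θ, hfix, hneg, hdich, hχ⟩ := hloc (v.adicCompletion K)
    exact map_kummerLocalConditionAt_adicCompletion_eq_of_hasGoodReductionAt_of_mem_maxUnramified W φ φ' hφ'φ hφφ' v θ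
      hfix hneg hdich hχ hv hα (fun s hs ↦ hsq ⟨s, hs⟩)

end Packaged

end Summit.BirchSwinnertonDyer.BirchSwinnertonDyer.Theorems.GenusKolyArch

end
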